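import Summits.AtomisticToContinuum.BoseEinsteinCondensation.Theorems.BECInsertionCorrectorCorrectorClosureFactorisationExact
import Summits.AtomisticToContinuum.BoseEinsteinCondensation.Theorems.BECInsertionCorrectorCorrectorClosureSplit
import HarnessLib

/-!
# Strategy census s3 (independent, family `s`) for crux `BECInsertionCorrector.CorrectorClosure`
# (item stmt-AtomisticToContinuum-12058) — kernel-checked FLOOR CERTIFICATE

Pure logic over landed theorems; no new mathematics. It records, by name, the three facts the census
`STRATEGY-CENSUS-s3.md` argues from:

* `floor_of_correctorClosure`: the crux implies the FLOOR `StaticResponseBound → PeriodicBECAll`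
  (torus BEC of near-minimisers for every admissible `v`, = the body of item stmt-8997), via the landed
  `periodicBEC_of_correctorClosure` (p121285);
* `closes_of_floor`: the floor is a drop-in replacement for the crux in the route's deciding theorem —
  `closes` consumes `CorrectorClosure` only through `ResidueCondenses (CorrectorClosure K1)`, i.e. only
  through torus BEC; so NO statement weaker than the floor can replace the crux in `closes`;
* `closes_of_child1_only`: after the landed exact split (p169803,
  `correctorClosure_iff_of_staticResponseBound : CorrectorClosure ↔ PeriodicBECAll ∧ InsertionResidueOfBEC`
  given K1) the deciding theorem needs ONLY child 1 and `BoundaryTransferWeak` — child 2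
  (`InsertionResidueOfBEC`), `ResidueCondenses` and even `StaticResponseBound` drop out of the cone;
* `floor_iff_periodicBEC_of_K1`: modulo the route's own rank-2 crux K1 the floor IS item 8997.
-/

open scoped ENNReal NNReal BigOperators ComplexConjugate

namespace Summit.AtomisticToContinuum.BoseEinsteinCondensation.Cruxes.CorrectorClosure.CensusS3

open Literature.MathematicalPhysics.QuantumManyBody.BoseGas
open Summit.AtomisticToContinuum.BoseEinsteinCondensation.Theses.BECInsertionCorrector
open Summit.AtomisticToContinuum.BoseEinsteinCondensation.Theorems.CorrectorClosure

/-- Torus BEC of near-minimisers for every admissible potential: verbatim the body of item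
stmt-AtomisticToContinuum-8997 (`PeriodicBEC`) = the hypothesis `BoundaryTransferWeak` consumes. -/
def PeriodicBECAll : Prop :=
  ∀ v : ℝ → ℝ≥0∞, IsRepulsiveFiniteRange v →
    ∃ ρ₀ : ℝ, 0 < ρ₀ ∧ ∀ ρ : ℝ, 0 < ρ → ρ < ρ₀ → ∃ c : ℝ, 0 < c ∧ ∀ᶠ N : ℕ in Filter.atTop,
      ∃ δ : ℝ≥0∞, 0 < δ ∧ ∀ Ψ : PeriodicTrialState N (sideLength ρ N),
        periodicEnergy v Ψ ≤ periodicGroundStateEnergy v N (sideLength ρ N) + δ →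
        ENNReal.ofReal (c * N) ≤ condensateOccupation N (sideLength ρ N) Ψ.ψ

/-- The FLOOR: torus BEC conditional on the static response bound. -/
def Floor : Prop := StaticResponseBound → PeriodicBECAll

/-- The crux implies the floor (landed factorisation `A ≤ f₀`, p121285). -/
theorem floor_of_correctorClosure (hCC : CorrectorClosure) : Floor :=
  fun hK1 => ResidueAreaLaw.periodicBEC_of_correctorClosure hCC hK1

/-- The floor replaces the crux in the route's deciding theorem: same binders as `closes` with
`CorrectorClosure`, `ResidueCondenses` replaced by `Floor`. -/
theorem closes_of_floor (h₁ : StaticResponseBound) (hX : Floor) (h₄ : BoundaryTransferWeak) :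
    _root_.BoseEinsteinCondensation :=
  fun v hv => h₄ v hv (hX h₁ v hv)

/-- Cone collapse after the split: child 1 (item 8997) and `BoundaryTransferWeak` alone decide the
summit; child 2, `ResidueCondenses` and `StaticResponseBound` are not load-bearing. -/
theorem closes_of_child1_only (hP : PeriodicBECAll) (h₄ : BoundaryTransferWeak) :
    _root_.BoseEinsteinCondensation :=
  fun v hv => h₄ v hv (hP v hv)

/-- Modulo K1 the floor is literally item 8997. -/
theorem floor_iff_periodicBEC_of_K1 (hK1 : StaticResponseBound) : Floor ↔ PeriodicBECAll :=
  ⟨fun h => h hK1, fun h _ => h⟩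

/-- The landed exact split, re-exported in this file's vocabulary: given K1,
`CorrectorClosure ↔ PeriodicBECAll ∧ (K1 → ∀ v, PeriodicBEC v → InsertionResidue v)`. -/
theorem correctorClosure_iff_split (hK1 : StaticResponseBound) :
    CorrectorClosure ↔ (PeriodicBECAll ∧ (StaticResponseBound → ∀ v : ℝ → ℝ≥0∞, IsRepulsiveFiniteRange v →
      (∃ ρ₀ : ℝ, 0 < ρ₀ ∧ ∀ ρ : ℝ, 0 < ρ → ρ < ρ₀ → ∃ c : ℝ, 0 < c ∧ ∀ᶠ N : ℕ in Filter.atTop,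
        ∃ δ : ℝ≥0∞, 0 < δ ∧ ∀ Ψ : PeriodicTrialState N (sideLength ρ N),
          periodicEnergy v Ψ ≤ periodicGroundStateEnergy v N (sideLength ρ N) + δ →
          ENNReal.ofReal (c * N) ≤ condensateOccupation N (sideLength ρ N) Ψ.ψ) →
      ∃ ρ₀ : ℝ, 0 < ρ₀ ∧ ∀ ρ : ℝ, 0 < ρ → ρ < ρ₀ → ∃ c : ℝ, 0 < c ∧ ∀ᶠ N : ℕ in Filter.atTop,
        ∃ δ : ℝ≥0∞, 0 < δ ∧ ∃ Θ : PeriodicTrialState N (sideLength ρ (N + 1)),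
          periodicEnergy v Θ ≤ periodicGroundStateEnergy v N (sideLength ρ (N + 1)) + δ ∧
          ∀ Ψ : PeriodicTrialState (N + 1) (sideLength ρ (N + 1)),
            periodicEnergy v Ψ ≤ periodicGroundStateEnergy v (N + 1) (sideLength ρ (N + 1)) + δ →
            ENNReal.ofReal c ≤ ENNReal.ofReal ((sideLength ρ (N + 1) ^ 3)⁻¹) *
              (‖∫ X in cellN N (sideLength ρ (N + 1)), conj (Θ.ψ X) *
                  ∫ x in cell (sideLength ρ (N + 1)), Ψ.ψ (Matrix.vecCons x X)‖₊ : ℝ≥0∞) ^ 2)) :=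
  Split.correctorClosure_iff_of_staticResponseBound hK1

end Summit.AtomisticToContinuum.BoseEinsteinCondensation.Cruxes.CorrectorClosure.CensusS3
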